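import Mathlib.MeasureTheory.Constructions.Pi
import Mathlib.MeasureTheory.Integral.Prod
import Literature.MathematicalPhysics.QuantumFieldTheory.LatticeGaugeProofs
import HarnessLib

/-!
# Gauge-boot: resampling one link of a product measure (one-coordinate Fubini) and the torus Wilson state

Cell `ym-instrument` (HOME `run/shared/lean/pub/ym-instrument/`), crew (a), seat `ym-instrument-boot-lean-1`;
A-plan-11 «BESSEL CAP» typing, file 1/6 (the measure-theoretic tool; general lattice-gauge measure theory over the
tree's `ConstructiveQFTWave0` / `LatticeGaugeProofs` vocabulary).

HONEST FRAMING (page 1 of every file of this cell): this file is pure measure theory on a finite product of copies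
of a probability measure and its Gibbs reweighting; it certifies nothing about any lattice gauge theory at any
`(G, D, L, β)`; nothing here is summit-bearing (no mass gap, no continuum statement, no string tension).

## Content

* `linkResample i (x, y) = x[i ↦ y]`, the resampling map of coordinate `i`, and `measurePreserving_linkResample`:
  for a probability measure `μ` and a finite index type it pushes `μ^{⊗ι} ⊗ μ` forward to `μ^{⊗ι}` — "resampling
  coordinate `i` independently does not change the product law".
* `integral_pi_eq_integral_integral_update`: `∫ f dμ^{⊗ι} = ∫ (∫ f(x[i ↦ y]) dμ(y)) dμ^{⊗ι}(x)` for integrable `f`;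
  `integral_pi_eq_of_integral_update_eq`: two integrable functions with the same one-coordinate conditional
  integrals have the same integral.
* `wilsonExpectation_eq_of_integral_update_eq`: the same for the torus Wilson state of the tree
  (`ConstructiveQFTWave0.wilsonExpectation`): if the one-LINK integrals of `h₁ e^{-βS}` and `h₂ e^{-βS}` agree at every
  configuration, then `⟨h₁⟩_β = ⟨h₂⟩_β` (bounded measurable `h₁, h₂`, continuous representation). This is the form in
  which the heat-bath / "integrate one link against its staples" step of Creutz (Phys. Rev. D 21 (1980) 2308, §III)
  enters the a-priori Wilson-loop bound of file `BesselCap`.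

Not here: anything specific to `SU(2)`, words, staples or Bessel functions (files `WordUpdate`, `SU2OneLinkMean`,
`StapleSplit`, `BesselCap`).
-/

noncomputable section

open MeasureTheory Set Function
open scoped ENNReal

namespace Summit.QuantumFields.GaugeBoot

/-! ## Resampling one coordinate of a product probability measure -/

section Pi

variable {ι : Type*} [Fintype ι] [DecidableEq ι] {α : Type*} [MeasurableSpace α]
  (μ : Measure α) [IsProbabilityMeasure μ]

omit [Fintype ι] [MeasurableSpace α] in
/-- The RESAMPLING MAP of coordinate `i`: `(x, y) ↦ x[i ↦ y]` (replace the `i`-th coordinate of the configuration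
`x` by the fresh value `y`). [folklore] -/
def linkResample (i : ι) (p : (ι → α) × α) : ι → α := update p.1 i p.2

omit [Fintype ι] [MeasurableSpace α] in
/-- Unfolding lemma `linkResample_apply`. [folklore] -/
@[simp] theorem linkResample_apply (i : ι) (p : (ι → α) × α) : linkResample i p = update p.1 i p.2 := rfl

omit [Fintype ι] in
/-- The resampling map is measurable (Mathlib `measurable_update'`). [folklore] -/
theorem measurable_linkResample (i : ι) : Measurable (linkResample (α := α) i) := measurable_update'

/-- **Resampling one coordinate preserves the product law**: for a probability measure `μ`, the push-forward of
`μ^{⊗ι} ⊗ μ` under `(x, y) ↦ x[i ↦ y]` is `μ^{⊗ι}` (checked on measurable boxes, Mathlib `Measure.pi_eq`). [folklore] -/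
theorem measurePreserving_linkResample (i : ι) :
    MeasurePreserving (linkResample i) ((Measure.pi fun _ : ι => μ).prod μ) (Measure.pi fun _ : ι => μ) := by
  refine ⟨measurable_linkResample i, ?_⟩
  symm
  refine Measure.pi_eq fun s hs => ?_
  rw [Measure.map_apply (measurable_linkResample i) (MeasurableSet.univ_pi hs)]
  -- the preimage of the box is a box (with the `i`-th side replaced by `univ`) times the `i`-th side
  have hpre : (linkResample i) ⁻¹' Set.pi univ s = (Set.pi univ (update s i univ)) ×ˢ s i := by
    ext p
    simp only [mem_preimage, linkResample_apply, mem_univ_pi, mem_prod]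
    constructor
    · intro h
      refine ⟨fun j => ?_, by simpa using h i⟩
      by_cases hj : j = i
      · subst hj; simp
      · have := h j
        rw [update_of_ne hj] at this
        rw [update_of_ne hj]
        exact this
    · rintro ⟨h1, h2⟩ j
      by_cases hj : j = i
      · subst hj; simpa using h2
      · rw [update_of_ne hj]
        have := h1 j
        rwa [update_of_ne hj] at this
  rw [hpre, Measure.prod_prod, Measure.pi_pi]
  have hupd : (fun j => μ (update s i univ j)) = update (fun j => μ (s j)) i (μ univ) := by
    funext j
    by_cases hj : j = i
    · subst hj; simp
    · rw [update_of_ne hj, update_of_ne hj]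
  rw [show (∏ j, μ (update s i univ j)) = ∏ j, update (fun j => μ (s j)) i (μ univ) j from
      Finset.prod_congr rfl fun j _ => congrFun hupd j,
    Finset.prod_update_of_mem (Finset.mem_univ i), measure_univ, one_mul,
    ← Finset.mul_prod_erase Finset.univ (fun j => μ (s j)) (Finset.mem_univ i), mul_comm,
    Finset.sdiff_singleton_eq_erase]

variable {E : Type*} [NormedAddCommGroup E] [NormedSpace ℝ E]

/-- **One-coordinate Fubini for the product law**: `∫ f dμ^{⊗ι} = ∫ (∫ f(x[i ↦ y]) dμ(y)) dμ^{⊗ι}(x)` for every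
integrable `f`. [folklore] -/
theorem integral_pi_eq_integral_integral_update (i : ι) {f : (ι → α) → E}
    (hf : Integrable f (Measure.pi fun _ : ι => μ)) :
    ∫ x, f x ∂(Measure.pi fun _ : ι => μ) =
      ∫ x, (∫ y, f (update x i y) ∂μ) ∂(Measure.pi fun _ : ι => μ) := by
  have hΦ := measurePreserving_linkResample μ i
  have h1 : ∫ x, f x ∂(Measure.pi fun _ : ι => μ) =
      ∫ p, f (linkResample i p) ∂((Measure.pi fun _ : ι => μ).prod μ) := by
    conv_lhs => rw [← hΦ.map_eq]
    rw [integral_map hΦ.measurable.aemeasurable]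
    rw [hΦ.map_eq]
    exact hf.aestronglyMeasurable
  rw [h1]
  have hint : Integrable (fun p : (ι → α) × α => f (linkResample i p)) ((Measure.pi fun _ : ι => μ).prod μ) :=
    (hΦ.integrable_comp hf.aestronglyMeasurable).2 hf
  exact integral_prod _ hint

/-- **Two integrable functions with the same conditional integrals over one coordinate have the same integral.**
[folklore] -/
theorem integral_pi_eq_of_integral_update_eq (i : ι) {f g : (ι → α) → E}
    (hf : Integrable f (Measure.pi fun _ : ι => μ)) (hg : Integrable g (Measure.pi fun _ : ι => μ))
    (h : ∀ x : ι → α, ∫ y, f (update x i y) ∂μ = ∫ y, g (update x i y) ∂μ) :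
    ∫ x, f x ∂(Measure.pi fun _ : ι => μ) = ∫ x, g x ∂(Measure.pi fun _ : ι => μ) := by
  rw [integral_pi_eq_integral_integral_update μ i hf, integral_pi_eq_integral_integral_update μ i hg]
  exact integral_congr_ae (Filter.Eventually.of_forall h)

end Pi

/-! ## The torus Wilson state: equality of expectations from equality of one-link integrals -/

section Wilson

open Literature.MathematicalPhysics.QuantumFieldTheory

variable {d L N : ℕ} {G : Type*} [Group G] [TopologicalSpace G] [IsTopologicalGroup G] [CompactSpace G]
  [MeasurableSpace G] [BorelSpace G] [SecondCountableTopology G] (ρ : G →* Matrix (Fin N) (Fin N) ℂ)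

/-- The torus expectation as a normalised product-Haar integral of `h · e^{-β S}` (Bochner form; any measurable `h`,
the non-negative version being the tree's `wilsonExpectation_eq_toReal_lintegral`). [folklore] -/
theorem wilsonExpectation_eq_inv_mul_integral [NeZero L] (hρ : Continuous ρ) (β : ℝ)
    (h : GaugeConfig d L G → ℝ) :
    wilsonExpectation ρ β h =
      ((partitionFunction (d := d) (L := L) ρ β)⁻¹).toReal *
        ∫ U, Real.exp (-β * wilsonAction ρ U) * h U ∂(Measure.pi fun _ : Edge d L => haarProbability G) := by
  have hw : Measurable fun U : GaugeConfig d L G => ENNReal.ofReal (Real.exp (-β * wilsonAction ρ U)) :=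
    (Real.measurable_exp.comp ((measurable_wilsonAction ρ hρ).const_mul _)).ennreal_ofReal
  unfold wilsonExpectation wilsonMeasure wilsonWeight
  rw [integral_smul_measure, integral_withDensity_eq_integral_toReal_smul hw
    (Filter.Eventually.of_forall fun _ => ENNReal.ofReal_lt_top)]
  simp only [smul_eq_mul, ENNReal.toReal_ofReal (Real.exp_nonneg _)]

/-- **Equal one-link integrals give equal torus expectations.** If `h₁, h₂` are bounded measurable observables on
the torus configurations and, for one fixed link `e`, the integrals of `e^{-βS} h₁` and `e^{-βS} h₂` over the link
variable `U_e` (all other links frozen) agree at every configuration, then `⟨h₁⟩_{Λ,β} = ⟨h₂⟩_{Λ,β}`. This is the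
measure-theoretic content of the one-link heat-bath step (Creutz 1980 §III; used in file `BesselCap`). [folklore] -/
theorem wilsonExpectation_eq_of_integral_update_eq [NeZero L] (hρ : Continuous ρ) (β : ℝ) (e : Edge d L)
    {h₁ h₂ : GaugeConfig d L G → ℝ} (hm₁ : Measurable h₁) (hm₂ : Measurable h₂)
    (hb₁ : ∃ C, ∀ U, |h₁ U| ≤ C) (hb₂ : ∃ C, ∀ U, |h₂ U| ≤ C)
    (h : ∀ U : GaugeConfig d L G,
      ∫ g, Real.exp (-β * wilsonAction ρ (update U e g)) * h₁ (update U e g) ∂(haarProbability G) =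
        ∫ g, Real.exp (-β * wilsonAction ρ (update U e g)) * h₂ (update U e g) ∂(haarProbability G)) :
    wilsonExpectation ρ β h₁ = wilsonExpectation ρ β h₂ := by
  obtain ⟨B, hB⟩ := exists_abs_wilsonAction_le (d := d) (L := L) ρ hρ
  have hwm : Measurable fun U : GaugeConfig d L G => Real.exp (-β * wilsonAction ρ U) :=
    Real.measurable_exp.comp ((measurable_wilsonAction ρ hρ).const_mul _)
  -- integrability of the two bounded measurable integrands on the probability space
  have hint : ∀ {h : GaugeConfig d L G → ℝ}, Measurable h → (∃ C, ∀ U, |h U| ≤ C) →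
      Integrable (fun U => Real.exp (-β * wilsonAction ρ U) * h U)
        (Measure.pi fun _ : Edge d L => haarProbability G) := by
    intro h hm hb
    obtain ⟨C, hC⟩ := hb
    refine Integrable.of_bound (hwm.mul hm).aestronglyMeasurable (Real.exp (|β| * B) * C)
      (Filter.Eventually.of_forall fun U => ?_)
    rw [Real.norm_eq_abs, abs_mul, Real.abs_exp]
    have hC0 : 0 ≤ C := (abs_nonneg _).trans (hC U)
    refine mul_le_mul ?_ (hC U) (abs_nonneg _) (Real.exp_nonneg _)
    refine Real.exp_le_exp.2 ?_
    have h1 : |β * wilsonAction ρ U| ≤ |β| * B := by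
      rw [abs_mul]; exact mul_le_mul_of_nonneg_left (hB U) (abs_nonneg _)
    have h2 := (abs_le.1 h1).1
    linarith
  rw [wilsonExpectation_eq_inv_mul_integral ρ hρ β h₁, wilsonExpectation_eq_inv_mul_integral ρ hρ β h₂,
    integral_pi_eq_of_integral_update_eq (haarProbability G) e (hint hm₁ hb₁) (hint hm₂ hb₂) h]

end Wilson

end Summit.QuantumFields.GaugeBoot

end
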